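import Literature.Analysis.FluidPDE.LeiZhang2011Proofs
import HarnessLib

/-!
# Lei–Zhang 2011, Theorem 1.2: the smooth axisymmetric setting extracted from the hypotheses

Analysis/FluidPDE proofs file (theorems only), on the discharge path of the named fact
`Literature.Analysis.FluidPDE.LeiZhang2011_liouville` (Z. Lei, Q. S. Zhang, J. Funct. Anal. 261
(2011) = arXiv:1011.5066, Theorem 1.2). Step 1 of the printed proof (Theorem 1.1 of the paper
applied to the ancient solution, p. 12) works with a smooth representative. Here the hypotheses
of the tree form of the fact — a bounded weak solution on `(−∞, 0) × ℝ³`, axisymmetric a.e.,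
with `|Γ| = |r u_θ| ≤ C` a.e. and a differentiable `BMO` stream function for a.e. time — are
converted into that setting, using KNSS 2009, §4 with (5.10) as proved in the tree
(`KNSS2009_regularity_axisymmetric_swirl_holds`): a smooth axisymmetric divergence-free
representative `U` with bounded derivatives, Lipschitz in time, an axial parasitic part
`β(t) e_z`, the swirl equation in time-integrated form, and in addition

* the swirl bound **everywhere**: `|swirl (U t) x| ≤ C` for all `t < 0` and all `x`
  (a.e. bound, `u(t) = U(t) + β(t)e_z` a.e., `swirl` does not see the axial constant,
  continuity in `x` and in `t`);
* the stream function relative to the representative: `curl (B t) = U t + β t e_z` a.e., for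
  a.e. `t < 0`.

## References

* Z. Lei, Q. S. Zhang, J. Funct. Anal. 261 (2011) = arXiv:1011.5066, Thm. 1.2 and proof §4
  (p. 12). [LeiZhang2011]
* G. Koch, N. Nadirashvili, G. Seregin, V. Šverák, Acta Math. 203 (2009), §4 (4.6)–(4.8) and
  (5.10). [KochNadirashviliSereginSverak2009]
-/

noncomputable section

open MeasureTheory Set Function Filter Metric
open _root_.Topology
open scoped InnerProductSpace RealInnerProductSpace NNReal Laplacian ContDiff

namespace Literature.Analysis.FluidPDE

namespace LeiZhang2011

open Literature.Analysis.FunctionSpaces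

/-- The swirl does not see an axial constant: `swirl (U + β e_z) = swirl U`. [folklore] -/
theorem swirl_add_smul_eZ (U : EuclideanSpace ℝ (Fin 3) → EuclideanSpace ℝ (Fin 3)) (β : ℝ)
    (x : EuclideanSpace ℝ (Fin 3)) : swirl (fun y => U y + β • eZ) x = swirl U x := by
  simp [swirl, eZ]

/-- A continuous real function bounded by `C` almost everywhere on an open set is bounded by
`C` everywhere on it (`max f C = C` a.e. and continuity, `Measure.eqOn_open_of_ae_eq`).
[folklore] -/
theorem le_of_ae_le_of_continuousOn {X : Type*} [TopologicalSpace X] [MeasurableSpace X]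
    {μ : Measure X} [μ.IsOpenPosMeasure] {f : X → ℝ} {S : Set X} (hS : IsOpen S)
    (hf : ContinuousOn f S) {C : ℝ} (h : ∀ᵐ x ∂(μ.restrict S), f x ≤ C) :
    ∀ x ∈ S, f x ≤ C := by
  have hmax : (fun x => max (f x) C) =ᵐ[μ.restrict S] fun _ => C := by
    filter_upwards [h] with x hx
    exact max_eq_right hx
  have hmaxc : ContinuousOn (fun x => max (f x) C) S :=
    continuous_max.comp_continuousOn (hf.prodMk continuousOn_const)
  have heq := Measure.eqOn_open_of_ae_eq hmax hS hmaxc continuousOn_const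
  intro x hx
  have := heq hx
  simp only at this
  exact (le_max_left _ _).trans this.le

/-- **The smooth setting of step 1.** Under the hypotheses of the tree form of Lei–Zhang's
Theorem 1.2 (`LeiZhang2011_liouville`): there are a representative `U`, an axial parasitic
part `β` and constants with all the conclusions of KNSS 2009, §4/(5.10)
(`KNSS2009_regularity_axisymmetric_swirl_holds`: `u = U + β e_z` a.e., `U(t)` smooth,
divergence free, axisymmetric, `‖∇ᵏU‖ ≤ C_k`, `∇ᵏU` Lipschitz in time, the swirl equation for
`Γ = swirl ∘ U` off the axis in time-integrated form), and moreover `|swirl (U t) x| ≤ C₀`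
for **all** `t < 0`, `x`, and the stream function of the hypothesis satisfies
`curl (B t) = U t + β t e_z` a.e. for a.e. `t < 0`. [cite: LeiZhang2011, proof of Thm. 1.2 (arXiv p. 12), the setting of Thm. 1.1] -/
theorem exists_setting ⦃u : ℝ → EuclideanSpace ℝ (Fin 3) → EuclideanSpace ℝ (Fin 3)⦄
    (hu : IsBoundedWeakNSSolutionOn (Iio 0) isOpen_Iio 1 u)
    (haxi : ∀ θ : ℝ, ∀ᵐ t ∂(volume.restrict (Iio (0 : ℝ))),
      (fun x => u t (rotZ θ x)) =ᵐ[volume] fun x => rotZ θ (u t x))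
    (hΓ : ∃ C : ℝ, ∀ᵐ t ∂(volume.restrict (Iio (0 : ℝ))),
      ∀ᵐ x ∂(volume : Measure (EuclideanSpace ℝ (Fin 3))), |swirl (u t) x| ≤ C)
    (hB : ∃ (B : ℝ → EuclideanSpace ℝ (Fin 3) → EuclideanSpace ℝ (Fin 3)) (C : ℝ≥0),
      ∀ᵐ t ∂(volume.restrict (Iio (0 : ℝ))),
        Differentiable ℝ (B t) ∧ curl (B t) =ᵐ[volume] u t ∧ eBMOSeminormVec (B t) ≤ C) :
    ∃ (U : ℝ → EuclideanSpace ℝ (Fin 3) → EuclideanSpace ℝ (Fin 3)) (β : ℝ → ℝ)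
      (B : ℝ → EuclideanSpace ℝ (Fin 3) → EuclideanSpace ℝ (Fin 3)) (C₀ : ℝ) (Cst : ℝ≥0),
      Measurable β ∧ (∃ C : ℝ, ∀ t, |β t| ≤ C) ∧ Measurable (uncurry U) ∧
      (∀ᵐ t ∂(volume.restrict (Iio (0 : ℝ))), u t =ᵐ[volume] fun x => U t x + β t • eZ) ∧
      (∀ t < 0, ContDiff ℝ ∞ (U t)) ∧
      (∀ t < 0, VectorCalculus.IsDivFree (U t)) ∧
      (∀ t < 0, IsAxisymmetric (U t)) ∧
      (∀ k : ℕ, ∃ C : ℝ, ∀ t < 0, ∀ x, ‖iteratedFDeriv ℝ k (U t) x‖ ≤ C) ∧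
      (∀ k : ℕ, ∃ L : ℝ, ∀ s < 0, ∀ t < 0, ∀ x,
        ‖iteratedFDeriv ℝ k (U t) x - iteratedFDeriv ℝ k (U s) x‖ ≤ L * |t - s|) ∧
      (∀ x, cylRadius x ≠ 0 → ∀ s t : ℝ, s ≤ t → t < 0 →
        swirl (U t) x - swirl (U s) x =
          ∫ τ in s..t, ((Δ (swirl (U τ))) x - fderiv ℝ (swirl (U τ)) x (U τ x + β τ • eZ) -
            2 / cylRadius x * partialDeriv (eR x) (swirl (U τ)) x)) ∧
      (∀ t < 0, ∀ x, |swirl (U t) x| ≤ C₀) ∧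
      (∀ᵐ t ∂(volume.restrict (Iio (0 : ℝ))), Differentiable ℝ (B t) ∧
        curl (B t) =ᵐ[volume] (fun x => U t x + β t • eZ) ∧ eBMOSeminormVec (B t) ≤ Cst) := by
  obtain ⟨U, β, hβm, hβb, hUm, hrep, hsm, hdiv, hax, hbd, hlip, hswirl⟩ :=
    KNSS2009_regularity_axisymmetric_swirl_holds hu haxi
  obtain ⟨C, hC⟩ := hΓ
  obtain ⟨B, Cst, hBt⟩ := hB
  refine ⟨U, β, B, max C 0, Cst, hβm, hβb, hUm, hrep, hsm, hdiv, hax, hbd, hlip, hswirl, ?_, ?_⟩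
  · -- the swirl bound everywhere
    -- (i) for a.e. `t < 0`: everywhere in `x`
    have hae : ∀ᵐ t ∂(volume.restrict (Iio (0 : ℝ))), ∀ x, |swirl (U t) x| ≤ max C 0 := by
      filter_upwards [hC, hrep, ae_restrict_mem measurableSet_Iio] with t ht hrt htneg
      have hcont : Continuous fun x => |swirl (U t) x| := by
        have hUc : Continuous (U t) := (hsm t htneg).continuous
        have h0 : Continuous fun x => U t x 0 := continuous_apply_of_continuous hUc 0
        have h1 : Continuous fun x => U t x 1 := continuous_apply_of_continuous hUc 1
        have hx0 : Continuous fun x : EuclideanSpace ℝ (Fin 3) => x 0 :=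
          (EuclideanSpace.proj (𝕜 := ℝ) (0 : Fin 3)).continuous
        have hx1 : Continuous fun x : EuclideanSpace ℝ (Fin 3) => x 1 :=
          (EuclideanSpace.proj (𝕜 := ℝ) (1 : Fin 3)).continuous
        simp only [swirl]
        exact ((hx0.mul h1).sub (hx1.mul h0)).abs
      have haex : ∀ᵐ x ∂(volume : Measure (EuclideanSpace ℝ (Fin 3))),
          |swirl (U t) x| ≤ max C 0 := by
        filter_upwards [ht, hrt] with x hx hux
        have : swirl (u t) x = swirl (U t) x := by
          rw [show swirl (u t) x = swirl (fun y => U t y + β t • eZ) x by simp [swirl, hux],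
            swirl_add_smul_eZ]
        rw [← this]
        exact hx.trans (le_max_left _ _)
      have h := le_of_ae_le_of_continuousOn (μ := (volume : Measure (EuclideanSpace ℝ (Fin 3))))
        isOpen_univ hcont.continuousOn (C := max C 0) (by rwa [Measure.restrict_univ])
      exact fun x => h x (mem_univ x)
    -- (ii) for every `t < 0`, by continuity in time (Lipschitz bound, `k = 0`)
    intro t ht x
    obtain ⟨L, hL⟩ := hlip 0
    have hcontt : ContinuousOn (fun s => |swirl (U s) x|) (Iio 0) := by
      have hlipU : ∀ s < 0, ∀ s' < 0, ‖U s' x - U s x‖ ≤ L * |s' - s| := by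
        intro s hs s' hs'
        rw [norm_sub_eq_norm_iteratedFDeriv_zero_sub]
        exact hL s hs s' hs' x
      -- continuity of `s ↦ U s x` on `Iio 0`
      have hUc : ContinuousOn (fun s => U s x) (Iio 0) := by
        intro s hs
        rw [ContinuousWithinAt, Metric.tendsto_nhds]
        intro ε hε
        have hmem : ∀ᶠ s' in 𝓝[Iio 0] s, s' ∈ Iio (0 : ℝ) := self_mem_nhdsWithin
        have hclose : ∀ᶠ s' in 𝓝[Iio 0] s, |s' - s| < ε / (|L| + 1) :=
          (Metric.tendsto_nhds.1 (tendsto_nhdsWithin_of_tendsto_nhds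
            (continuous_id.tendsto s))) _ (by positivity)
        filter_upwards [hmem, hclose] with s' hs' hcl
        rw [dist_eq_norm]
        calc ‖U s' x - U s x‖ ≤ L * |s' - s| := hlipU s hs s' hs'
          _ ≤ |L| * |s' - s| := mul_le_mul_of_nonneg_right (le_abs_self L) (abs_nonneg _)
          _ < |L| * (ε / (|L| + 1)) + ε / (|L| + 1) := by
              have : 0 < ε / (|L| + 1) := by positivity
              nlinarith [abs_nonneg L, mul_lt_mul_of_pos_left hcl (by positivity : (0:ℝ) < |L| + 1)]
          _ = ε := by field_simp
      have h0 : ContinuousOn (fun s => U s x 0) (Iio 0) :=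
        (EuclideanSpace.proj (𝕜 := ℝ) (0 : Fin 3)).continuous.comp_continuousOn hUc
      have h1 : ContinuousOn (fun s => U s x 1) (Iio 0) :=
        (EuclideanSpace.proj (𝕜 := ℝ) (1 : Fin 3)).continuous.comp_continuousOn hUc
      simp only [swirl]
      exact ((continuousOn_const.mul h1).sub (continuousOn_const.mul h0)).abs
    have hae' : ∀ᵐ s ∂(volume.restrict (Iio (0 : ℝ))), |swirl (U s) x| ≤ max C 0 := by
      filter_upwards [hae] with s hs
      exact hs x
    exact le_of_ae_le_of_continuousOn isOpen_Iio hcontt hae' t ht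
  · -- the stream function relative to the representative
    filter_upwards [hBt, hrep] with t ht hrt
    exact ⟨ht.1, ht.2.1.trans hrt, ht.2.2⟩

end LeiZhang2011

end Literature.Analysis.FluidPDE
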